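import Literature.AlgebraicGeometry.PlaneCurves.SingularPointsEnvelopes
import HarnessLib

/-!
# Nodal affine plane curves: the Hessian test and the product (transversality) criterion

Topic `Literature/AlgebraicGeometry/PlaneCurves`, namespace `Literature.AlgebraicGeometry.PlaneCurves.AffineNodalCurves`.
Everything here is PROVED (definitions + lemmas over an arbitrary field); no named fact, nothing conditional.
Written by the prover seat `leafhand-hodge-q8symplecticpowers-4` (g5, cell `pub-hsemireg`) as the algebraic engine of the
branch-curve genericity step (lemma Zb-4 «nodal genericity») behind the registered stub S1 `stub_regularVeryGeneralQ` of
route `HodgeConjecture/Q8SymplecticPowers` (crux K1Q, stmt-HodgeConjecture-24190): the branch curve of the route's double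
plane is a PRODUCT `y · s · (s - 1) · (s + 1) · ψ̃(s, y)` of smooth components in each chart of `𝔽₂`, and «the total branch
curve has only ordinary double points» is exactly the conclusion of `IsNodal.mul` ∕ `IsNodal.prod` below from smoothness of
the factors, pairwise transversality and the absence of triple points. Honest scope: elementary commutative algebra of plane
curve equations; nothing here bears on HC, and S1 ∕ K1Q are NOT proved here.

Sources. W. Fulton, *Algebraic Curves* (2008 ed.), §3.1 «Multiple points and tangent lines»: writing `F = F_m + F_{m+1} + ⋯`
at `P = (0,0)`, `m = m_P(F)` is the multiplicity, the linear factors of the lowest form `F_m` are the tangent lines, and `P` is an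
*ordinary* multiple point if `F_m` has `m` distinct tangents; «an ordinary double point is called a node»; and (ibid., property of
multiplicities of a product) `m_P(FG) = m_P(F) + m_P(G)`, the tangent cone of `FG` being the product of the tangent cones — so
two curves smooth at `P` with distinct tangents there give a node of `FG`. Barth–Peters–Van de Ven, *Compact Complex Surfaces*
(1984), II §8: the simple curve singularity `A₁` («ordinary double point», local equation `x² + y² = 0`, i.e. `xy = 0`), the
case in which the quadratic part is non-degenerate. We use the Hessian determinant of the quadratic part as the test
«`F_2` has two distinct tangents» (non-degenerate binary quadratic form ⟺ non-zero discriminant; in characteristic `2` the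
Hessian test is stronger than, not equivalent to, «two distinct tangents», which is harmless for a sufficient criterion and
exact in characteristic `≠ 2`).

## Dictionary (reusing `SingularPointsEnvelopes`: `grad f p`, `IsSingularPoint f p = (f(p) = 0 ∧ ∇f(p) = 0)`)

* `hess f p i j = (∂ᵢ∂ⱼ f)(p)`, `hessDet f p` = the determinant of the `2 × 2` Hessian of `f` at `p` (at a singular point this
  is the discriminant, up to sign, of the quadratic part `F_2` of `f` at `p`).
* `IsOrdinaryDoublePoint f p` — `p` is a singular point of `V(f)` with non-degenerate Hessian (a node, `A₁`).
* `IsNodalAt f p` — IF `p` is a singular point of `V(f)` THEN it is an ordinary double point; `IsNodal f = ∀ p, IsNodalAt f p`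
  («the affine curve `f = 0` has at most nodes»; it forces `f` to be squarefree away from units, since a square factor makes
  every one of its points singular with degenerate Hessian — not needed below).
* `jac f g p = ∇f(p) × ∇g(p)` (the `2 × 2` Jacobian determinant) — `≠ 0` iff `V(f)` and `V(g)` are both smooth at `p` with
  distinct tangent lines (transversal).

## What is here

* §1 Leibniz rules at a point: `grad_mul_apply`, `hess_mul` (`∂ᵢ∂ⱼ(fg) = (∂ᵢ∂ⱼf)g + ∂ⱼf ∂ᵢg + ∂ᵢf ∂ⱼg + f ∂ᵢ∂ⱼg` evaluated at `p`).
* §2 Two branches through `p` (`f(p) = g(p) = 0`): `p` is singular on `V(fg)` (`isSingularPoint_mul_of_eval_eq_zero`),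
  `hessDet (f*g) p = -(jac f g p)²` (`hessDet_mul_of_eval_eq_zero`), hence transversal branches give a NODE
  (`isOrdinaryDoublePoint_mul_of_jac_ne_zero`, `isNodalAt_mul_of_jac_ne_zero`).
* §3 A unit factor at `p` (`g(p) ≠ 0`): singularity and nodality of `fg` at `p` are those of `f`
  (`isSingularPoint_mul_iff_of_eval_ne_zero`, `hessDet_mul_of_isSingularPoint`, `isNodalAt_mul_of_eval_ne_zero_right/left`).
* §4 Global criteria: smooth curves are nodal (`isNodal_of_forall_not_isSingularPoint`); **`IsNodal.mul`**: `f`, `g` nodal and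
  transversal wherever they meet ⇒ `fg` nodal; **`IsNodal.prod`**: a finite product of nodal curves, pairwise transversal at
  common points and with no point on three factors, is nodal (`grad_prod_of_eval_eq_zero` computes `∇(∏ fᵢ)(p)` when exactly
  one factor vanishes at `p`).

NOT here: the converse (a node of `fg` with `f(p) = g(p) = 0` forces transversality — true, not needed), projective closures,
intersection multiplicities.

## References
* [Fulton2008] W. Fulton, *Algebraic Curves. An Introduction to Algebraic Geometry* (2008), §3.1 (multiple points, tangent
  lines, ordinary multiple points, nodes; multiplicity and tangents of a product).
* [BarthPetersVandeVen1984] W. Barth, C. Peters, A. Van de Ven, *Compact Complex Surfaces* (1984), II §8 (simple curve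
  singularities, `A₁` = ordinary double point).
* [CoxLittleOShea2007] D. Cox, J. Little, D. O'Shea, *Ideals, Varieties, and Algorithms* (2007), Ch. 3 §4 Def. 3 (singular
  points; the tree's `IsSingularPoint`, `grad`).
-/

set_option autoImplicit false

open MvPolynomial

namespace Literature.AlgebraicGeometry.PlaneCurves.AffineNodalCurves

open Literature.AlgebraicGeometry.PlaneCurves.SingularPointsEnvelopes

variable {k : Type*} [Field k]

/-! ## Definitions -/

/-- The Hessian entry `(∂ᵢ∂ⱼ f)(p)` of an affine plane curve equation `f ∈ k[x, y]` at a point `p`.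
[cite: Fulton2008, §3.1 (the forms `F_m` of `F` at `P`; `F_2` for a double point)] -/
noncomputable def hess (f : MvPolynomial (Fin 2) k) (p : Fin 2 → k) (i j : Fin 2) : k :=
  MvPolynomial.eval p (pderiv i (pderiv j f))

/-- The Hessian determinant `(∂ₓ∂ₓf)(∂ᵧ∂ᵧf) − (∂ₓ∂ᵧf)(∂ᵧ∂ₓf)` at `p`; at a double point it is (minus) the discriminant of the
quadratic part `F_2`, non-zero iff `F_2` is a non-degenerate quadratic form. [cite: Fulton2008, §3.1 (ordinary multiple
points: `F_m` with `m` distinct tangents; nodes)] -/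
noncomputable def hessDet (f : MvPolynomial (Fin 2) k) (p : Fin 2 → k) : k :=
  hess f p 0 0 * hess f p 1 1 - hess f p 0 1 * hess f p 1 0

/-- `p` is an ORDINARY DOUBLE POINT (node, `A₁`) of the affine curve `f = 0`: a singular point with non-degenerate Hessian.
[cite: Fulton2008, §3.1 («an ordinary double point is called a node»)] [cite: BarthPetersVandeVen1984, II §8 (`A₁`)] -/
def IsOrdinaryDoublePoint (f : MvPolynomial (Fin 2) k) (p : Fin 2 → k) : Prop :=
  IsSingularPoint f p ∧ hessDet f p ≠ 0

/-- The curve `f = 0` is NODAL AT `p`: if `p` is a singular point of it, then `p` is an ordinary double point.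
[cite: Fulton2008, §3.1 (nodes)] [cite: BarthPetersVandeVen1984, II §8 (`A₁`)] -/
def IsNodalAt (f : MvPolynomial (Fin 2) k) (p : Fin 2 → k) : Prop :=
  IsSingularPoint f p → hessDet f p ≠ 0

/-- The affine curve `f = 0` is NODAL: every singular point is an ordinary double point («at most nodes»).
[cite: Fulton2008, §3.1 (nodes)] [cite: BarthPetersVandeVen1984, II §8 (`A₁`)] -/
def IsNodal (f : MvPolynomial (Fin 2) k) : Prop :=
  ∀ p, IsNodalAt f p

/-- The Jacobian determinant `∇f(p) × ∇g(p) = ∂ₓf ∂ᵧg − ∂ᵧf ∂ₓg` at `p`: non-zero iff the two gradients are linearly independent,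
i.e. both curves are smooth at `p` with distinct tangent lines (they meet TRANSVERSALLY at `p`).
[cite: Fulton2008, §3.1 (tangent lines; distinct tangents)] -/
noncomputable def jac (f g : MvPolynomial (Fin 2) k) (p : Fin 2 → k) : k :=
  grad f p 0 * grad g p 1 - grad f p 1 * grad g p 0

variable {f g : MvPolynomial (Fin 2) k} {p : Fin 2 → k}

/-- Unfolding `IsNodalAt`. [cite: Fulton2008, §3.1 (nodes)] -/
theorem isNodalAt_iff : IsNodalAt f p ↔ (IsSingularPoint f p → hessDet f p ≠ 0) := Iff.rfl

/-- An ordinary double point is a point at which the curve is nodal. [cite: Fulton2008, §3.1 (nodes)] -/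
theorem IsOrdinaryDoublePoint.isNodalAt (h : IsOrdinaryDoublePoint f p) : IsNodalAt f p := fun _ => h.2

/-- At a singular point, «nodal at `p`» means «ordinary double point». [cite: Fulton2008, §3.1 (nodes)] -/
theorem isNodalAt_iff_isOrdinaryDoublePoint (h : IsSingularPoint f p) :
    IsNodalAt f p ↔ IsOrdinaryDoublePoint f p :=
  ⟨fun hn => ⟨h, hn h⟩, fun ho _ => ho.2⟩

/-- A non-singular point (in particular a point off the curve, or a smooth point of it) is trivially nodal.
[cite: Fulton2008, §3.1 (simple points)] -/
theorem isNodalAt_of_not_isSingularPoint (h : ¬ IsSingularPoint f p) : IsNodalAt f p := fun hs => (h hs).elim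

/-- A curve without singular points (a smooth affine curve, or a unit) is nodal. [cite: Fulton2008, §3.1 (simple points)] -/
theorem isNodal_of_forall_not_isSingularPoint (h : ∀ p, ¬ IsSingularPoint f p) : IsNodal f :=
  fun p => isNodalAt_of_not_isSingularPoint (h p)

/-- The Jacobian determinant is antisymmetric. [cite: Fulton2008, §3.1 (tangent lines)] -/
theorem jac_swap (f g : MvPolynomial (Fin 2) k) (p : Fin 2 → k) : jac g f p = -jac f g p := by
  unfold jac; ring

/-- If `∇f(p) = 0` then `∇f(p) × ∇g(p) = 0`: transversality at `p` forces both curves to be smooth at `p`.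
[cite: Fulton2008, §3.1 (tangent lines)] -/
theorem jac_eq_zero_of_grad_eq_zero (h : grad f p = 0) : jac f g p = 0 := by
  have h0 : grad f p 0 = 0 := by rw [h]; rfl
  have h1 : grad f p 1 = 0 := by rw [h]; rfl
  unfold jac; rw [h0, h1]; ring

/-! ## §1 Leibniz rules at a point -/

/-- `∂ᵢ(fg)(p) = ∂ᵢf(p) g(p) + f(p) ∂ᵢg(p)`. [cite: Fulton2008, §3.1 (multiplicity of a product `m_P(FG) = m_P(F) + m_P(G)`)] -/
theorem grad_mul_apply (f g : MvPolynomial (Fin 2) k) (p : Fin 2 → k) (i : Fin 2) :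
    grad (f * g) p i = grad f p i * MvPolynomial.eval p g + MvPolynomial.eval p f * grad g p i := by
  simp only [grad_apply, pderiv_mul, map_add, map_mul]

/-- `∂ᵢ∂ⱼ(fg)(p) = ∂ᵢ∂ⱼf(p) g(p) + ∂ⱼf(p) ∂ᵢg(p) + ∂ᵢf(p) ∂ⱼg(p) + f(p) ∂ᵢ∂ⱼg(p)`.
[cite: Fulton2008, §3.1 (multiplicity and tangents of a product)] -/
theorem hess_mul (f g : MvPolynomial (Fin 2) k) (p : Fin 2 → k) (i j : Fin 2) :
    hess (f * g) p i j = hess f p i j * MvPolynomial.eval p g + grad f p j * grad g p i +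
      grad f p i * grad g p j + MvPolynomial.eval p f * hess g p i j := by
  simp only [hess, grad_apply, pderiv_mul, map_add, map_mul]
  ring

/-! ## §2 Two branches through `p` -/

/-- If `f(p) = g(p) = 0` then `p` is a singular point of `fg = 0` (multiplicity `≥ 2`).
[cite: Fulton2008, §3.1 (`m_P(FG) = m_P(F) + m_P(G)`)] -/
theorem isSingularPoint_mul_of_eval_eq_zero (hf : MvPolynomial.eval p f = 0) (hg : MvPolynomial.eval p g = 0) :
    IsSingularPoint (f * g) p := by
  refine ⟨by rw [map_mul, hf, zero_mul], ?_⟩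
  funext i
  rw [grad_mul_apply, hf, hg, mul_zero, zero_mul, add_zero]
  rfl

/-- If `f(p) = g(p) = 0` then the Hessian determinant of `fg` at `p` is `-(∇f(p) × ∇g(p))²`: the quadratic part of `fg` at `p`
is the product of the two tangent linear forms. [cite: Fulton2008, §3.1 (tangent cone of a product)] -/
theorem hessDet_mul_of_eval_eq_zero (hf : MvPolynomial.eval p f = 0) (hg : MvPolynomial.eval p g = 0) :
    hessDet (f * g) p = -(jac f g p) ^ 2 := by
  simp only [hessDet, hess_mul, hf, hg, mul_zero, zero_mul, add_zero, zero_add, jac]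
  ring

/-- **Two transversal smooth branches make a node**: if `f(p) = g(p) = 0` and `∇f(p) × ∇g(p) ≠ 0` then `p` is an ordinary
double point of `fg = 0`. [cite: Fulton2008, §3.1 (ordinary multiple points; `m_P(FG) = m_P(F) + m_P(G)`)]
[cite: BarthPetersVandeVen1984, II §8 (`A₁`: local equation `xy = 0`)] -/
theorem isOrdinaryDoublePoint_mul_of_jac_ne_zero (hf : MvPolynomial.eval p f = 0) (hg : MvPolynomial.eval p g = 0)
    (hj : jac f g p ≠ 0) : IsOrdinaryDoublePoint (f * g) p := by
  refine ⟨isSingularPoint_mul_of_eval_eq_zero hf hg, ?_⟩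
  rw [hessDet_mul_of_eval_eq_zero hf hg]
  exact neg_ne_zero.2 (pow_ne_zero 2 hj)

/-- If `f(p) = g(p) = 0` and the branches are transversal at `p`, then `fg` is nodal at `p`.
[cite: Fulton2008, §3.1 (nodes)] -/
theorem isNodalAt_mul_of_jac_ne_zero (hf : MvPolynomial.eval p f = 0) (hg : MvPolynomial.eval p g = 0)
    (hj : jac f g p ≠ 0) : IsNodalAt (f * g) p :=
  (isOrdinaryDoublePoint_mul_of_jac_ne_zero hf hg hj).isNodalAt

/-! ## §3 A factor that is a unit at `p` -/

/-- If `g(p) ≠ 0`, then `p` is a singular point of `fg = 0` iff it is one of `f = 0`.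
[cite: Fulton2008, §3.1 (`m_P(FG) = m_P(F) + m_P(G)`, `m_P(G) = 0` for `G(P) ≠ 0`)] -/
theorem isSingularPoint_mul_iff_of_eval_ne_zero (hg : MvPolynomial.eval p g ≠ 0) :
    IsSingularPoint (f * g) p ↔ IsSingularPoint f p := by
  constructor
  · rintro ⟨h0, h1⟩
    rw [map_mul] at h0
    have hf : MvPolynomial.eval p f = 0 := (mul_eq_zero.1 h0).resolve_right hg
    refine ⟨hf, funext fun i => ?_⟩
    have hi := congrFun h1 i
    rw [grad_mul_apply, hf, zero_mul, add_zero] at hi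
    exact (mul_eq_zero.1 hi).resolve_right hg
  · rintro ⟨hf, h1⟩
    refine ⟨by rw [map_mul, hf, zero_mul], funext fun i => ?_⟩
    have hi : grad f p i = 0 := by rw [h1]; rfl
    rw [grad_mul_apply, hf, hi, zero_mul, zero_mul, add_zero]
    rfl

/-- At a singular point `p` of `f = 0`, the Hessian of `fg` is `g(p)` times that of `f`, so
`hessDet (fg) p = g(p)² · hessDet f p`. [cite: Fulton2008, §3.1 (the lowest form of `FG` at `P` is `F_m · G(P)` when `G(P) ≠ 0`)] -/
theorem hessDet_mul_of_isSingularPoint (h : IsSingularPoint f p) :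
    hessDet (f * g) p = MvPolynomial.eval p g ^ 2 * hessDet f p := by
  have h0 : grad f p 0 = 0 := by rw [h.2]; rfl
  have h1 : grad f p 1 = 0 := by rw [h.2]; rfl
  simp only [hessDet, hess_mul, h.1, zero_mul, add_zero]
  have e : ∀ i j : Fin 2, grad f p j * grad g p i + grad f p i * grad g p j = 0 := by
    intro i j; fin_cases i <;> fin_cases j <;> simp [h0, h1]
  have e' : ∀ i j : Fin 2, hess f p i j * MvPolynomial.eval p g + grad f p j * grad g p i + grad f p i * grad g p j =
      hess f p i j * MvPolynomial.eval p g := by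
    intro i j; rw [add_assoc, e i j, add_zero]
  simp only [e']
  ring

/-- If `g(p) ≠ 0` and `f = 0` is nodal at `p`, then `fg = 0` is nodal at `p`. [cite: Fulton2008, §3.1 (nodes; `m_P(G) = 0`)] -/
theorem isNodalAt_mul_of_eval_ne_zero_right (hg : MvPolynomial.eval p g ≠ 0) (h : IsNodalAt f p) :
    IsNodalAt (f * g) p := by
  intro hs
  have hs' : IsSingularPoint f p := (isSingularPoint_mul_iff_of_eval_ne_zero hg).1 hs
  rw [hessDet_mul_of_isSingularPoint hs']
  exact mul_ne_zero (pow_ne_zero 2 hg) (h hs')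

/-- If `f(p) ≠ 0` and `g = 0` is nodal at `p`, then `fg = 0` is nodal at `p`. [cite: Fulton2008, §3.1 (nodes; `m_P(F) = 0`)] -/
theorem isNodalAt_mul_of_eval_ne_zero_left (hf : MvPolynomial.eval p f ≠ 0) (h : IsNodalAt g p) :
    IsNodalAt (f * g) p := by
  rw [mul_comm]
  exact isNodalAt_mul_of_eval_ne_zero_right hf h

/-! ## §4 Global criteria -/

/-- **Product criterion.** If `f = 0` and `g = 0` are nodal affine curves meeting transversally at every common point
(`f(p) = g(p) = 0 ⇒ ∇f(p) × ∇g(p) ≠ 0` — in particular they share no singular point), then `fg = 0` is nodal.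
[cite: Fulton2008, §3.1 (ordinary multiple points of a product)] [cite: BarthPetersVandeVen1984, II §8 (`A₁`)] -/
theorem IsNodal.mul (hf : IsNodal f) (hg : IsNodal g)
    (hj : ∀ p, MvPolynomial.eval p f = 0 → MvPolynomial.eval p g = 0 → jac f g p ≠ 0) : IsNodal (f * g) := by
  intro p
  by_cases hfp : MvPolynomial.eval p f = 0
  · by_cases hgp : MvPolynomial.eval p g = 0
    · exact isNodalAt_mul_of_jac_ne_zero hfp hgp (hj p hfp hgp)
    · exact isNodalAt_mul_of_eval_ne_zero_right hgp (hf p)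
  · exact isNodalAt_mul_of_eval_ne_zero_left hfp (hg p)

/-- The gradient of a finite product at a point where the factor `F j` vanishes:
`∇(∏ᵢ Fᵢ)(p) = (∏_{i ≠ j} Fᵢ(p)) · ∇F_j(p)`. [cite: Fulton2008, §3.1 (`m_P(FG) = m_P(F) + m_P(G)`)] -/
theorem grad_prod_of_eval_eq_zero {ι : Type*} [DecidableEq ι] (s : Finset ι) (F : ι → MvPolynomial (Fin 2) k)
    {j : ι} (hj : j ∈ s) (h0 : MvPolynomial.eval p (F j) = 0) (i : Fin 2) :
    grad (∏ l ∈ s, F l) p i = (∏ l ∈ s.erase j, MvPolynomial.eval p (F l)) * grad (F j) p i := by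
  rw [← Finset.mul_prod_erase s F hj, grad_mul_apply, h0, zero_mul, add_zero, map_prod, mul_comm]

/-- **Finite product criterion.** A finite product `∏_{i ∈ s} Fᵢ` of nodal affine curves which are pairwise transversal at
their common points and such that no point lies on three of them is nodal — the singular points of the product are the
singular points of the factors and the (transversal) pairwise intersections. [cite: Fulton2008, §3.1 (ordinary multiple
points; multiplicity of a product)] [cite: BarthPetersVandeVen1984, II §8 (`A₁`)] -/
theorem IsNodal.prod {ι : Type*} [DecidableEq ι] (s : Finset ι) (F : ι → MvPolynomial (Fin 2) k)
    (hF : ∀ i ∈ s, IsNodal (F i))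
    (hjac : ∀ i ∈ s, ∀ j ∈ s, i ≠ j → ∀ p, MvPolynomial.eval p (F i) = 0 → MvPolynomial.eval p (F j) = 0 →
      jac (F i) (F j) p ≠ 0)
    (h3 : ∀ i ∈ s, ∀ j ∈ s, ∀ l ∈ s, i ≠ j → i ≠ l → j ≠ l → ∀ p, MvPolynomial.eval p (F i) = 0 →
      MvPolynomial.eval p (F j) = 0 → MvPolynomial.eval p (F l) ≠ 0) :
    IsNodal (∏ i ∈ s, F i) := by
  classical
  induction s using Finset.induction_on with
  | empty =>
    rw [Finset.prod_empty]
    refine isNodal_of_forall_not_isSingularPoint fun p hs => ?_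
    have := hs.1
    rw [map_one] at this
    exact one_ne_zero this
  | insert a s ha ih =>
    rw [Finset.prod_insert ha]
    have hF' : ∀ i ∈ s, IsNodal (F i) := fun i hi => hF i (Finset.mem_insert_of_mem hi)
    have hjac' : ∀ i ∈ s, ∀ j ∈ s, i ≠ j → ∀ p, MvPolynomial.eval p (F i) = 0 → MvPolynomial.eval p (F j) = 0 →
        jac (F i) (F j) p ≠ 0 :=
      fun i hi j hj' => hjac i (Finset.mem_insert_of_mem hi) j (Finset.mem_insert_of_mem hj')
    have h3' : ∀ i ∈ s, ∀ j ∈ s, ∀ l ∈ s, i ≠ j → i ≠ l → j ≠ l → ∀ p, MvPolynomial.eval p (F i) = 0 →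
        MvPolynomial.eval p (F j) = 0 → MvPolynomial.eval p (F l) ≠ 0 :=
      fun i hi j hj' l hl => h3 i (Finset.mem_insert_of_mem hi) j (Finset.mem_insert_of_mem hj') l
        (Finset.mem_insert_of_mem hl)
    refine IsNodal.mul (hF a (Finset.mem_insert_self a s)) (ih hF' hjac' h3') fun p hap hprod => ?_
    -- some factor `F j`, `j ∈ s`, vanishes at `p`; no third factor does
    obtain ⟨j, hjs, hj0⟩ := Finset.prod_eq_zero_iff.1 (by rwa [map_prod] at hprod)
    have haj : a ≠ j := fun h => ha (h ▸ hjs)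
    have hothers : ∀ l ∈ s.erase j, MvPolynomial.eval p (F l) ≠ 0 := by
      intro l hl
      obtain ⟨hlj, hls⟩ := Finset.mem_erase.1 hl
      exact h3 a (Finset.mem_insert_self a s) j (Finset.mem_insert_of_mem hjs) l (Finset.mem_insert_of_mem hls) haj
        (fun h => (h ▸ ha) hls) (Ne.symm hlj) p hap hj0
    have hne : (∏ l ∈ s.erase j, MvPolynomial.eval p (F l)) ≠ 0 := Finset.prod_ne_zero_iff.2 hothers
    have e : jac (F a) (∏ i ∈ s, F i) p = (∏ l ∈ s.erase j, MvPolynomial.eval p (F l)) * jac (F a) (F j) p := by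
      unfold jac
      rw [grad_prod_of_eval_eq_zero s F hjs hj0 0, grad_prod_of_eval_eq_zero s F hjs hj0 1]
      ring
    rw [e]
    exact mul_ne_zero hne (hjac a (Finset.mem_insert_self a s) j (Finset.mem_insert_of_mem hjs) haj p hap hj0)

end Literature.AlgebraicGeometry.PlaneCurves.AffineNodalCurves
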